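import Summits.KontsevichZagierPeriods.Zeta5Search.Barrier.ConeGammaCuspSlopeTangentConeWalls

/-!
# ζ(5) search — BARRIER: THE TANGENT CONE OF THE TRANSLATE INTEGRAL INSIDE THE RATE BALL — differentiability and extremum
# criteria at EVERY translate (file (3) of «THE UNIFORM TANGENT CONE»)

HONEST FRAMING (cell `pub-zeta5`): systematic search; no irrationality claim unless kernel-certified. MODEL objects
under Brown–Zudilin's (28)+(30) accounting ([BZ22] = arXiv:2210.03391; (28) observed, not proved); nothing here is a
statement about `ζ(5)`, any `γ` of record, the cone's supremum (C2 OPEN) or the value / sign of the translate integral, of a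
chamber weight, of a wall defect or of a derivative at a named direction (DATA of the cell); the rate-ball radius at a named
direction is DATA; NO cancellation is quantified; S-E / (TD_A) stay CONJECTURED; records in print UNMOVED. Prover P2 g43
(item «THE UNIFORM TANGENT CONE», file (3); plan INBOX 2026-08-28). Sources: files (1)–(2) `ConeGammaCuspSlopeTangentCone[Walls]`,
P2 g42 `ConeGammaTranslateRateBall` (`translateIntegral_sub_eq_cuspSlope_sub_of_rates_le`: on the rate ball `P − σ` is constant).

SETTING. `a` with all 28 forms positive, `T > 0` a period, `P = translateIntegral a T`, `σ = cuspSlope a T`, `F` the canonical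
period pattern function, `W_k(δ₀)` the canonical chamber weights; the OPEN RATE BALL: `|r_k(δ)| < ρ̄` for all `k` with
`2ρ̄·T·x_max² < 1`, `2ρ̄·x_max < 1`, `2ρ̄·x_max < wallDist a T`.
* `translateIntegral_eventuallyEq_cuspSlope_add` — at a translate `δ` of the open ball, `P = σ + (P(δ) − σ(δ))` on a
  neighbourhood; hence **`differentiableAt_translateIntegral_iff_cuspSlope`**, **`fderiv_translateIntegral_eq_fderiv_cuspSlope`**
  (no hypothesis on differentiability: both sides are `0` where it fails);
* **`translateIntegral_eq_add_lex_functional_eventually` — THE TANGENT CONE OF `P` IS ATTAINED ON A NEIGHBOURHOOD** of every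
  translate of the open ball: `P(δ') = P(δ) + Σ_k W_k(δ₀)·r_k(δ' − δ)` for all `δ'` near `δ`, `δ₀` any lexicographic reference of
  `(δ, δ' − δ)`;
* **`differentiableAt_translateIntegral_iff_greedy_eq` — THE DIFFERENTIABILITY CRITERION FOR `P` AT EVERY TRANSLATE OF THE OPEN
  BALL (ties of any multiplicity)**: `P` is differentiable at `δ` iff any two generic references refining `δ` carry one chamber
  functional; `greedy_eq_fderiv_translateIntegral` (then each of them IS `fderiv P δ`);
  **`translateIntegral_eq_affine_near_of_differentiableAt` / `differentiableAt_translateIntegral_eventually`** (where `P` is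
  differentiable inside the ball it is AFFINE on a neighbourhood: open locus, locally constant gradient);
  **`differentiableAt_translateIntegral_of_modular_classes`** (modular tied classes ⇒ differentiable with the reference-free
  gradient `Σ_k (F(U_k ∪ {k}) − F(U_k))·r_k`); **`translateIntegral_defect_eq_zero_of_differentiableAt`** (two refining references
  one adjacent transposition apart force a zero pooled defect);
* **`isLocalMax_translateIntegral_iff` / `isLocalMin_translateIntegral_iff` — THE EXTREMUM CRITERION FOR `P`**: a translate
  `δ` of the open ball is a local maximiser (minimiser) of `P` iff every one-sided directional derivative — every lexicographic
  chamber functional of `(δ, Δ)` at `Δ` — is `≤ 0` (`≥ 0`); `translateIntegral_eventually_const_of_isLocalExtr` — a local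
  extremum of `P` at a differentiability point of the ball is FLAT (every strict local extremum inside the ball is a kink point).
NOT here (honest): the rate-ball radius, any `W_k`, `m_F`, gradient or sign at a named direction (DATA); translates beyond the
ball ((TD_A) CONJECTURED); `Φ`, `γ`, C2, S-E's truth, `ζ(5)`.
-/

noncomputable section

open Set Finset Filter
open scoped Topology

namespace Summit.KontsevichZagierPeriods.Zeta5Search.Barrier.ConeGamma

/-! ### Inside the open ball, `P` and `σ` differ by a constant near every translate -/

/-- Points near a translate of the OPEN rate ball lie in the CLOSED rate ball. -/
theorem eventually_rates_le_of_rates_lt {a : Dir} {δ : Fin 8 → ℝ} {ρb : ℝ} (hρ : ∀ k, |phiForm δ k / h28 a k| < ρb) :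
    ∀ᶠ δ' in 𝓝 δ, ∀ k, |phiForm δ' k / h28 a k| ≤ ρb := by
  rw [Filter.eventually_all]
  intro k
  have hc : Continuous fun θ : Fin 8 → ℝ => phiForm θ k / h28 a k := (continuous_phiForm k).div_const _
  filter_upwards [(hc.abs.continuousAt).eventually_lt continuousAt_const (hρ k)] with δ' h
  exact h.le

/-- **Near a translate `δ` of the open rate ball, `P = σ + (P(δ) − σ(δ))`.** -/
theorem translateIntegral_eventuallyEq_cuspSlope_add {a : Dir} (hpos : ∀ k, 0 < h28 a k) {T : ℝ} (hT : 0 < T)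
    (hper : ∀ k : Fin 28, ∃ z : ℤ, T * h28 a k = z) {δ : Fin 8 → ℝ} {ρb : ℝ}
    (hρ : ∀ k, |phiForm δ k / h28 a k| < ρb) (hρT : 2 * ρb * T * xMax a ^ 2 < 1) (hc1 : 2 * ρb * xMax a < 1)
    (hc2 : 2 * ρb * xMax a < wallDist a T) :
    translateIntegral a T =ᶠ[𝓝 δ] fun δ' => cuspSlope a T δ' + (translateIntegral a T δ - cuspSlope a T δ) := by
  filter_upwards [eventually_rates_le_of_rates_lt hρ] with δ' hδ'
  have h := translateIntegral_sub_eq_cuspSlope_sub_of_rates_le hpos hT hper hδ' (fun k => (hρ k).le) hρT hc1 hc2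
  linarith

/-- **Inside the open rate ball, `P` is differentiable at `δ` iff `σ` is.** -/
theorem differentiableAt_translateIntegral_iff_cuspSlope {a : Dir} (hpos : ∀ k, 0 < h28 a k) {T : ℝ} (hT : 0 < T)
    (hper : ∀ k : Fin 28, ∃ z : ℤ, T * h28 a k = z) {δ : Fin 8 → ℝ} {ρb : ℝ}
    (hρ : ∀ k, |phiForm δ k / h28 a k| < ρb) (hρT : 2 * ρb * T * xMax a ^ 2 < 1) (hc1 : 2 * ρb * xMax a < 1)
    (hc2 : 2 * ρb * xMax a < wallDist a T) :
    DifferentiableAt ℝ (translateIntegral a T) δ ↔ DifferentiableAt ℝ (cuspSlope a T) δ := by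
  rw [(translateIntegral_eventuallyEq_cuspSlope_add hpos hT hper hρ hρT hc1 hc2).differentiableAt_iff,
    differentiableAt_add_const_iff]

/-- **Inside the open rate ball, `fderiv P δ = fderiv σ δ`** (both are `0` where differentiability fails). -/
theorem fderiv_translateIntegral_eq_fderiv_cuspSlope {a : Dir} (hpos : ∀ k, 0 < h28 a k) {T : ℝ} (hT : 0 < T)
    (hper : ∀ k : Fin 28, ∃ z : ℤ, T * h28 a k = z) {δ : Fin 8 → ℝ} {ρb : ℝ}
    (hρ : ∀ k, |phiForm δ k / h28 a k| < ρb) (hρT : 2 * ρb * T * xMax a ^ 2 < 1) (hc1 : 2 * ρb * xMax a < 1)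
    (hc2 : 2 * ρb * xMax a < wallDist a T) :
    fderiv ℝ (translateIntegral a T) δ = fderiv ℝ (cuspSlope a T) δ := by
  rw [(translateIntegral_eventuallyEq_cuspSlope_add hpos hT hper hρ hρT hc1 hc2).fderiv_eq, fderiv_add_const]

/-! ### The tangent cone of `P` is attained on a neighbourhood -/

/-- **THE TANGENT CONE OF `P` IS ATTAINED ON A NEIGHBOURHOOD OF EVERY TRANSLATE OF THE OPEN BALL.** All 28 forms of `a`
positive, `T > 0` a period, `F` the canonical period pattern function, `δ` in the open rate ball. Then for all `δ'` near `δ` and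
every generic reference `δ₀` refining the lexicographic order of `(δ, δ' − δ)`:
**`P(δ') = P(δ) + Σ_k W_k(δ₀)·φ_k(δ' − δ)/h_k(a)`**. -/
theorem translateIntegral_eq_add_lex_functional_eventually {a : Dir} (hpos : ∀ k, 0 < h28 a k) {T : ℝ} (hT : 0 < T)
    (hper : ∀ k : Fin 28, ∃ z : ℤ, T * h28 a k = z) {F : Finset (Fin 28) → ℝ}
    (hF : ∀ A, F A = ∑ m ∈ Finset.range ((bkpts a T).card - 1), ((patternN a (bkpt a T m) A : ℤ) : ℝ))
    {δ : Fin 8 → ℝ} {ρb : ℝ} (hρ : ∀ k, |phiForm δ k / h28 a k| < ρb) (hρT : 2 * ρb * T * xMax a ^ 2 < 1)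
    (hc1 : 2 * ρb * xMax a < 1) (hc2 : 2 * ρb * xMax a < wallDist a T) :
    ∀ᶠ δ' in 𝓝 δ, ∀ δ₀ : Fin 8 → ℝ,
      (∀ k l : Fin 28, k ≠ l → phiForm δ₀ k / h28 a k ≠ phiForm δ₀ l / h28 a l) →
      (∀ k l : Fin 28, (phiForm δ k / h28 a k < phiForm δ l / h28 a l ∨
          (phiForm δ k / h28 a k = phiForm δ l / h28 a l ∧
            phiForm (δ' - δ) k / h28 a k < phiForm (δ' - δ) l / h28 a l)) →
        phiForm δ₀ k / h28 a k < phiForm δ₀ l / h28 a l) →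
      translateIntegral a T δ' = translateIntegral a T δ +
        ∑ k, (F (Finset.univ.filter fun l => phiForm δ₀ k / h28 a k ≤ phiForm δ₀ l / h28 a l) -
            F (Finset.univ.filter fun l => phiForm δ₀ k / h28 a k < phiForm δ₀ l / h28 a l)) *
          (phiForm (δ' - δ) k / h28 a k) := by
  filter_upwards [translateIntegral_eventuallyEq_cuspSlope_add hpos hT hper hρ hρT hc1 hc2,
    cuspSlope_eq_add_lex_functional_eventually hpos hT hper hF δ] with δ' hP hσ δ₀ hgen hlex
  rw [hP, hσ δ₀ hgen hlex]
  ring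

/-! ### The differentiability criterion for `P` at every translate of the open ball -/

/-- **THE DIFFERENTIABILITY CRITERION FOR `P` AT EVERY TRANSLATE OF THE OPEN BALL (ties of any multiplicity)**: `P` is
differentiable at `δ` iff any two generic references refining `δ` have the same canonical chamber functional. -/
theorem differentiableAt_translateIntegral_iff_greedy_eq {a : Dir} (hpos : ∀ k, 0 < h28 a k) {T : ℝ} (hT : 0 < T)
    (hper : ∀ k : Fin 28, ∃ z : ℤ, T * h28 a k = z) {F : Finset (Fin 28) → ℝ}
    (hF : ∀ A, F A = ∑ m ∈ Finset.range ((bkpts a T).card - 1), ((patternN a (bkpt a T m) A : ℤ) : ℝ))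
    {δ : Fin 8 → ℝ} {ρb : ℝ} (hρ : ∀ k, |phiForm δ k / h28 a k| < ρb) (hρT : 2 * ρb * T * xMax a ^ 2 < 1)
    (hc1 : 2 * ρb * xMax a < 1) (hc2 : 2 * ρb * xMax a < wallDist a T) :
    DifferentiableAt ℝ (translateIntegral a T) δ ↔
      ∀ δ₀ δ₀' : Fin 8 → ℝ, (∀ k l : Fin 28, k ≠ l → phiForm δ₀ k / h28 a k ≠ phiForm δ₀ l / h28 a l) →
        (∀ k l : Fin 28, k ≠ l → phiForm δ₀' k / h28 a k ≠ phiForm δ₀' l / h28 a l) →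
        (∀ k l : Fin 28, phiForm δ k / h28 a k < phiForm δ l / h28 a l →
          phiForm δ₀ k / h28 a k < phiForm δ₀ l / h28 a l) →
        (∀ k l : Fin 28, phiForm δ k / h28 a k < phiForm δ l / h28 a l →
          phiForm δ₀' k / h28 a k < phiForm δ₀' l / h28 a l) →
        ∀ Δ : Fin 8 → ℝ,
          ∑ k, (F (Finset.univ.filter fun l => phiForm δ₀ k / h28 a k ≤ phiForm δ₀ l / h28 a l) -
              F (Finset.univ.filter fun l => phiForm δ₀ k / h28 a k < phiForm δ₀ l / h28 a l)) *
            (phiForm Δ k / h28 a k) =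
          ∑ k, (F (Finset.univ.filter fun l => phiForm δ₀' k / h28 a k ≤ phiForm δ₀' l / h28 a l) -
              F (Finset.univ.filter fun l => phiForm δ₀' k / h28 a k < phiForm δ₀' l / h28 a l)) *
            (phiForm Δ k / h28 a k) := by
  rw [differentiableAt_translateIntegral_iff_cuspSlope hpos hT hper hρ hρT hc1 hc2]
  exact differentiableAt_cuspSlope_iff_greedy_eq hpos hT hper hF δ

/-- **Where `P` is differentiable inside the ball, the chamber functional of every generic reference refining `δ` IS
`fderiv P δ`.** -/
theorem greedy_eq_fderiv_translateIntegral {a : Dir} (hpos : ∀ k, 0 < h28 a k) {T : ℝ} (hT : 0 < T)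
    (hper : ∀ k : Fin 28, ∃ z : ℤ, T * h28 a k = z) {F : Finset (Fin 28) → ℝ}
    (hF : ∀ A, F A = ∑ m ∈ Finset.range ((bkpts a T).card - 1), ((patternN a (bkpt a T m) A : ℤ) : ℝ))
    {δ : Fin 8 → ℝ} {ρb : ℝ} (hρ : ∀ k, |phiForm δ k / h28 a k| < ρb) (hρT : 2 * ρb * T * xMax a ^ 2 < 1)
    (hc1 : 2 * ρb * xMax a < 1) (hc2 : 2 * ρb * xMax a < wallDist a T)
    (hd : DifferentiableAt ℝ (translateIntegral a T) δ) {δ₀ : Fin 8 → ℝ}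
    (hgen : ∀ k l : Fin 28, k ≠ l → phiForm δ₀ k / h28 a k ≠ phiForm δ₀ l / h28 a l)
    (href : ∀ k l : Fin 28, phiForm δ k / h28 a k < phiForm δ l / h28 a l →
      phiForm δ₀ k / h28 a k < phiForm δ₀ l / h28 a l) (Δ : Fin 8 → ℝ) :
    ∑ k, (F (Finset.univ.filter fun l => phiForm δ₀ k / h28 a k ≤ phiForm δ₀ l / h28 a l) -
          F (Finset.univ.filter fun l => phiForm δ₀ k / h28 a k < phiForm δ₀ l / h28 a l)) *
        (phiForm Δ k / h28 a k) = fderiv ℝ (translateIntegral a T) δ Δ := by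
  rw [fderiv_translateIntegral_eq_fderiv_cuspSlope hpos hT hper hρ hρT hc1 hc2]
  exact greedy_eq_fderiv_of_differentiableAt hpos hT hper hF
    ((differentiableAt_translateIntegral_iff_cuspSlope hpos hT hper hρ hρT hc1 hc2).mp hd) hgen href Δ

/-- **WHERE `P` IS DIFFERENTIABLE INSIDE THE BALL IT IS AFFINE ON A NEIGHBOURHOOD**:
`P(δ') = P(δ) + fderiv P δ (δ' − δ)` for all `δ'` near `δ`. -/
theorem translateIntegral_eq_affine_near_of_differentiableAt {a : Dir} (hpos : ∀ k, 0 < h28 a k) {T : ℝ} (hT : 0 < T)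
    (hper : ∀ k : Fin 28, ∃ z : ℤ, T * h28 a k = z) {δ : Fin 8 → ℝ} {ρb : ℝ}
    (hρ : ∀ k, |phiForm δ k / h28 a k| < ρb) (hρT : 2 * ρb * T * xMax a ^ 2 < 1) (hc1 : 2 * ρb * xMax a < 1)
    (hc2 : 2 * ρb * xMax a < wallDist a T) (hd : DifferentiableAt ℝ (translateIntegral a T) δ) :
    ∀ᶠ δ' in 𝓝 δ, translateIntegral a T δ' =
      translateIntegral a T δ + fderiv ℝ (translateIntegral a T) δ (δ' - δ) := by
  classical
  obtain ⟨F, hF⟩ : ∃ F : Finset (Fin 28) → ℝ,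
      ∀ A, F A = ∑ m ∈ Finset.range ((bkpts a T).card - 1), ((patternN a (bkpt a T m) A : ℤ) : ℝ) := ⟨_, fun _ => rfl⟩
  have hd' := (differentiableAt_translateIntegral_iff_cuspSlope hpos hT hper hρ hρT hc1 hc2).mp hd
  filter_upwards [translateIntegral_eventuallyEq_cuspSlope_add hpos hT hper hρ hρT hc1 hc2,
    cuspSlope_eq_affine_near_of_differentiableAt hpos hT hper hF hd'] with δ' hP hσ
  rw [hP, hσ, fderiv_translateIntegral_eq_fderiv_cuspSlope hpos hT hper hρ hρT hc1 hc2]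
  ring

/-- **THE DIFFERENTIABILITY LOCUS OF `P` INSIDE THE BALL IS OPEN AND THE GRADIENT IS LOCALLY CONSTANT ON IT.** -/
theorem differentiableAt_translateIntegral_eventually {a : Dir} (hpos : ∀ k, 0 < h28 a k) {T : ℝ} (hT : 0 < T)
    (hper : ∀ k : Fin 28, ∃ z : ℤ, T * h28 a k = z) {δ : Fin 8 → ℝ} {ρb : ℝ}
    (hρ : ∀ k, |phiForm δ k / h28 a k| < ρb) (hρT : 2 * ρb * T * xMax a ^ 2 < 1) (hc1 : 2 * ρb * xMax a < 1)
    (hc2 : 2 * ρb * xMax a < wallDist a T) (hd : DifferentiableAt ℝ (translateIntegral a T) δ) :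
    ∀ᶠ δ' in 𝓝 δ, DifferentiableAt ℝ (translateIntegral a T) δ' ∧
      fderiv ℝ (translateIntegral a T) δ' = fderiv ℝ (translateIntegral a T) δ := by
  filter_upwards [(translateIntegral_eq_affine_near_of_differentiableAt hpos hT hper hρ hρT hc1 hc2 hd).eventually_nhds]
    with δ' h'
  have h1 : HasFDerivAt (fun x => translateIntegral a T δ +
      (fderiv ℝ (translateIntegral a T) δ x - fderiv ℝ (translateIntegral a T) δ δ))
      (fderiv ℝ (translateIntegral a T) δ) δ' :=
    ((fderiv ℝ (translateIntegral a T) δ).hasFDerivAt.sub_const _).const_add (translateIntegral a T δ)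
  have heq : (fun x => translateIntegral a T δ +
      (fderiv ℝ (translateIntegral a T) δ x - fderiv ℝ (translateIntegral a T) δ δ)) =ᶠ[𝓝 δ']
      translateIntegral a T := by
    filter_upwards [h'] with x hx
    rw [hx, map_sub]
  have h2 := h1.congr_of_eventuallyEq heq.symm
  exact ⟨h2.differentiableAt, h2.fderiv⟩

/-- **MODULAR TIED CLASSES ⇒ `P` IS DIFFERENTIABLE INSIDE THE BALL, WITH THE REFERENCE-FREE GRADIENT**
`fderiv P δ Δ = Σ_k (F(U_k ∪ {k}) − F(U_k))·φ_k(Δ)/h_k(a)`, `U_k = {l : r_k(δ) < r_l(δ)}`. -/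
theorem differentiableAt_translateIntegral_of_modular_classes {a : Dir} (hpos : ∀ k, 0 < h28 a k) {T : ℝ} (hT : 0 < T)
    (hper : ∀ k : Fin 28, ∃ z : ℤ, T * h28 a k = z) {F : Finset (Fin 28) → ℝ}
    (hF : ∀ A, F A = ∑ m ∈ Finset.range ((bkpts a T).card - 1), ((patternN a (bkpt a T m) A : ℤ) : ℝ))
    {δ : Fin 8 → ℝ} {ρb : ℝ} (hρ : ∀ k, |phiForm δ k / h28 a k| < ρb) (hρT : 2 * ρb * T * xMax a ^ 2 < 1)
    (hc1 : 2 * ρb * xMax a < 1) (hc2 : 2 * ρb * xMax a < wallDist a T)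
    (hmod : ∀ k : Fin 28, ∀ B : Finset (Fin 28),
      B ⊆ Finset.univ.filter (fun l => phiForm δ l / h28 a l = phiForm δ k / h28 a k) →
        F (Finset.univ.filter (fun l => phiForm δ k / h28 a k < phiForm δ l / h28 a l) ∪ B) =
          F (Finset.univ.filter fun l => phiForm δ k / h28 a k < phiForm δ l / h28 a l) +
            ∑ j ∈ B, (F (insert j (Finset.univ.filter fun l => phiForm δ k / h28 a k < phiForm δ l / h28 a l)) -
              F (Finset.univ.filter fun l => phiForm δ k / h28 a k < phiForm δ l / h28 a l))) :
    DifferentiableAt ℝ (translateIntegral a T) δ ∧ ∀ Δ : Fin 8 → ℝ, fderiv ℝ (translateIntegral a T) δ Δ =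
      ∑ k, (F (insert k (Finset.univ.filter fun l => phiForm δ k / h28 a k < phiForm δ l / h28 a l)) -
          F (Finset.univ.filter fun l => phiForm δ k / h28 a k < phiForm δ l / h28 a l)) *
        (phiForm Δ k / h28 a k) := by
  have h := differentiableAt_cuspSlope_of_modular_classes hpos hT hper hF hmod
  rw [differentiableAt_translateIntegral_iff_cuspSlope hpos hT hper hρ hρT hc1 hc2,
    fderiv_translateIntegral_eq_fderiv_cuspSlope hpos hT hper hρ hρT hc1 hc2]
  exact h

/-- **WHERE `P` IS DIFFERENTIABLE INSIDE THE BALL, TWO REFINING REFERENCES ONE ADJACENT TRANSPOSITION APART HAVE ZERO POOLED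
DEFECT** (hypotheses as in file (2)'s `defect_eq_zero_of_differentiableAt`). -/
theorem translateIntegral_defect_eq_zero_of_differentiableAt {a : Dir} (hpos : ∀ k, 0 < h28 a k) {T : ℝ} (hT : 0 < T)
    (hper : ∀ k : Fin 28, ∃ z : ℤ, T * h28 a k = z) {F : Finset (Fin 28) → ℝ}
    (hF : ∀ A, F A = ∑ m ∈ Finset.range ((bkpts a T).card - 1), ((patternN a (bkpt a T m) A : ℤ) : ℝ))
    {δ : Fin 8 → ℝ} {ρb : ℝ} (hρ : ∀ k, |phiForm δ k / h28 a k| < ρb) (hρT : 2 * ρb * T * xMax a ^ 2 < 1)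
    (hc1 : 2 * ρb * xMax a < 1) (hc2 : 2 * ρb * xMax a < wallDist a T)
    (hd : DifferentiableAt ℝ (translateIntegral a T) δ) {δ₀ δ₀' : Fin 8 → ℝ}
    (hgen : ∀ k l : Fin 28, k ≠ l → phiForm δ₀ k / h28 a k ≠ phiForm δ₀ l / h28 a l)
    (hgen' : ∀ k l : Fin 28, k ≠ l → phiForm δ₀' k / h28 a k ≠ phiForm δ₀' l / h28 a l)
    (href : ∀ k l : Fin 28, phiForm δ k / h28 a k < phiForm δ l / h28 a l →
      phiForm δ₀ k / h28 a k < phiForm δ₀ l / h28 a l)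
    (href' : ∀ k l : Fin 28, phiForm δ k / h28 a k < phiForm δ l / h28 a l →
      phiForm δ₀' k / h28 a k < phiForm δ₀' l / h28 a l)
    {k l : Fin 28} (hkl : k ≠ l) (hρ₀ : phiForm δ₀ l / h28 a l < phiForm δ₀ k / h28 a k)
    (hρ₀' : phiForm δ₀' k / h28 a k < phiForm δ₀' l / h28 a l)
    (hadj : ∀ j : Fin 28, ¬(phiForm δ₀ l / h28 a l < phiForm δ₀ j / h28 a j ∧
      phiForm δ₀ j / h28 a j < phiForm δ₀ k / h28 a k))
    (hside : ∀ j : Fin 28, j ≠ k → j ≠ l →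
      (phiForm δ₀ k / h28 a k < phiForm δ₀ j / h28 a j ↔ phiForm δ₀' k / h28 a k < phiForm δ₀' j / h28 a j) ∧
        (phiForm δ₀ l / h28 a l < phiForm δ₀ j / h28 a j ↔ phiForm δ₀' l / h28 a l < phiForm δ₀' j / h28 a j))
    (hsame : ∀ i j : Fin 28, i ≠ k → i ≠ l → j ≠ k → j ≠ l →
      (phiForm δ₀ i / h28 a i < phiForm δ₀ j / h28 a j ↔ phiForm δ₀' i / h28 a i < phiForm δ₀' j / h28 a j)) :
    F (insert k (Finset.univ.filter fun j => phiForm δ₀ k / h28 a k < phiForm δ₀ j / h28 a j)) +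
        F (insert l (Finset.univ.filter fun j => phiForm δ₀ k / h28 a k < phiForm δ₀ j / h28 a j)) -
        F (Finset.univ.filter fun j => phiForm δ₀ k / h28 a k < phiForm δ₀ j / h28 a j) -
        F (insert k (insert l (Finset.univ.filter fun j => phiForm δ₀ k / h28 a k < phiForm δ₀ j / h28 a j))) = 0 :=
  defect_eq_zero_of_differentiableAt hpos hT hper hF
    ((differentiableAt_translateIntegral_iff_cuspSlope hpos hT hper hρ hρT hc1 hc2).mp hd)
    hgen hgen' href href' hkl hρ₀ hρ₀' hadj hside hsame

/-! ### THE EXTREMUM CRITERION for `P` -/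

/-- **A LOCAL EXTREMUM OF `P` AT A DIFFERENTIABILITY POINT OF THE BALL IS FLAT**: if `P` is differentiable at a local extremum `δ`
inside the open rate ball, then `P` is CONSTANT on a neighbourhood of `δ` — every strict local extremum of `P` inside the ball is a
kink point of the translate arrangement (two refining references with different functionals). -/
theorem translateIntegral_eventually_const_of_isLocalExtr {a : Dir} (hpos : ∀ k, 0 < h28 a k) {T : ℝ} (hT : 0 < T)
    (hper : ∀ k : Fin 28, ∃ z : ℤ, T * h28 a k = z) {δ : Fin 8 → ℝ} {ρb : ℝ}
    (hρ : ∀ k, |phiForm δ k / h28 a k| < ρb) (hρT : 2 * ρb * T * xMax a ^ 2 < 1) (hc1 : 2 * ρb * xMax a < 1)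
    (hc2 : 2 * ρb * xMax a < wallDist a T) (hd : DifferentiableAt ℝ (translateIntegral a T) δ)
    (hext : IsLocalExtr (translateIntegral a T) δ) :
    ∀ᶠ δ' in 𝓝 δ, translateIntegral a T δ' = translateIntegral a T δ := by
  filter_upwards [translateIntegral_eq_affine_near_of_differentiableAt hpos hT hper hρ hρT hc1 hc2 hd] with δ' h
  rw [h, hext.fderiv_eq_zero, zero_apply, add_zero]

/-- **THE LOCAL-MAXIMUM CRITERION FOR `P` INSIDE THE BALL**: a translate `δ` of the open rate ball is a local maximiser of `P` iff
every one-sided directional derivative at `δ` — every lexicographic chamber functional of `(δ, Δ)` at `Δ` — is `≤ 0`. -/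
theorem isLocalMax_translateIntegral_iff {a : Dir} (hpos : ∀ k, 0 < h28 a k) {T : ℝ} (hT : 0 < T)
    (hper : ∀ k : Fin 28, ∃ z : ℤ, T * h28 a k = z) {F : Finset (Fin 28) → ℝ}
    (hF : ∀ A, F A = ∑ m ∈ Finset.range ((bkpts a T).card - 1), ((patternN a (bkpt a T m) A : ℤ) : ℝ))
    {δ : Fin 8 → ℝ} {ρb : ℝ} (hρ : ∀ k, |phiForm δ k / h28 a k| < ρb) (hρT : 2 * ρb * T * xMax a ^ 2 < 1)
    (hc1 : 2 * ρb * xMax a < 1) (hc2 : 2 * ρb * xMax a < wallDist a T) :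
    IsLocalMax (translateIntegral a T) δ ↔
      ∀ Δ δ₀ : Fin 8 → ℝ, (∀ k l : Fin 28, k ≠ l → phiForm δ₀ k / h28 a k ≠ phiForm δ₀ l / h28 a l) →
        (∀ k l : Fin 28, (phiForm δ k / h28 a k < phiForm δ l / h28 a l ∨
            (phiForm δ k / h28 a k = phiForm δ l / h28 a l ∧ phiForm Δ k / h28 a k < phiForm Δ l / h28 a l)) →
          phiForm δ₀ k / h28 a k < phiForm δ₀ l / h28 a l) →
        ∑ k, (F (Finset.univ.filter fun l => phiForm δ₀ k / h28 a k ≤ phiForm δ₀ l / h28 a l) -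
            F (Finset.univ.filter fun l => phiForm δ₀ k / h28 a k < phiForm δ₀ l / h28 a l)) *
          (phiForm Δ k / h28 a k) ≤ 0 := by
  rw [(translateIntegral_eventuallyEq_cuspSlope_add hpos hT hper hρ hρT hc1 hc2).isLocalMax_iff,
    ← isLocalMax_cuspSlope_iff hpos hT hper hF δ]
  show (∀ᶠ x in 𝓝 δ, cuspSlope a T x + (translateIntegral a T δ - cuspSlope a T δ) ≤
      cuspSlope a T δ + (translateIntegral a T δ - cuspSlope a T δ)) ↔
    ∀ᶠ x in 𝓝 δ, cuspSlope a T x ≤ cuspSlope a T δ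
  simp only [add_le_add_iff_right]

/-- **THE LOCAL-MINIMUM CRITERION FOR `P` INSIDE THE BALL**: `δ` is a local minimiser of `P` iff every one-sided directional
derivative at `δ` is `≥ 0`. -/
theorem isLocalMin_translateIntegral_iff {a : Dir} (hpos : ∀ k, 0 < h28 a k) {T : ℝ} (hT : 0 < T)
    (hper : ∀ k : Fin 28, ∃ z : ℤ, T * h28 a k = z) {F : Finset (Fin 28) → ℝ}
    (hF : ∀ A, F A = ∑ m ∈ Finset.range ((bkpts a T).card - 1), ((patternN a (bkpt a T m) A : ℤ) : ℝ))
    {δ : Fin 8 → ℝ} {ρb : ℝ} (hρ : ∀ k, |phiForm δ k / h28 a k| < ρb) (hρT : 2 * ρb * T * xMax a ^ 2 < 1)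
    (hc1 : 2 * ρb * xMax a < 1) (hc2 : 2 * ρb * xMax a < wallDist a T) :
    IsLocalMin (translateIntegral a T) δ ↔
      ∀ Δ δ₀ : Fin 8 → ℝ, (∀ k l : Fin 28, k ≠ l → phiForm δ₀ k / h28 a k ≠ phiForm δ₀ l / h28 a l) →
        (∀ k l : Fin 28, (phiForm δ k / h28 a k < phiForm δ l / h28 a l ∨
            (phiForm δ k / h28 a k = phiForm δ l / h28 a l ∧ phiForm Δ k / h28 a k < phiForm Δ l / h28 a l)) →
          phiForm δ₀ k / h28 a k < phiForm δ₀ l / h28 a l) →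
        0 ≤ ∑ k, (F (Finset.univ.filter fun l => phiForm δ₀ k / h28 a k ≤ phiForm δ₀ l / h28 a l) -
            F (Finset.univ.filter fun l => phiForm δ₀ k / h28 a k < phiForm δ₀ l / h28 a l)) *
          (phiForm Δ k / h28 a k) := by
  rw [(translateIntegral_eventuallyEq_cuspSlope_add hpos hT hper hρ hρT hc1 hc2).isLocalMin_iff,
    ← isLocalMin_cuspSlope_iff hpos hT hper hF δ]
  show (∀ᶠ x in 𝓝 δ, cuspSlope a T δ + (translateIntegral a T δ - cuspSlope a T δ) ≤
      cuspSlope a T x + (translateIntegral a T δ - cuspSlope a T δ)) ↔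
    ∀ᶠ x in 𝓝 δ, cuspSlope a T δ ≤ cuspSlope a T x
  simp only [add_le_add_iff_right]

end Summit.KontsevichZagierPeriods.Zeta5Search.Barrier.ConeGamma

end
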